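import Summits.HodgeConjecture.CorCM.GaloisOddSylowOrder
import HarnessLib

/-!
# SYLOW COUNTING: when no divisor `d > 1` of `[Gal : P]` is `≡ 1 (mod p)`, the Sylow `p`-subgroup `P` is normal — so for GOOD Galois CM
# fields of degree `2ⁿ·pᵃ` with `ord_p(2) > n` (e.g. `p > 2ⁿ`) the `p`-part is at most `p`, with no size hypothesis

COR-CM (cell `pub-hodgecm2`), binder seat b04 (gen 38), count-neutral own lane «Galois-CM-type classification».  KERNEL ONLY:
theorems; no definition, no named fact, no `sorry`.  `HC_CM` is neither used nor claimed.

Sylow III: the number of Sylow `p`-subgroups divides the index `[G:P]` and is `≡ 1 (mod p)`; if `1` is the only such divisor, `P ◁ G`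
(`sylow_normal_of_forall_dvd_index`).  Combined with gen 38's «a normal Sylow `p`-subgroup (`p` odd) of index `≥ 14` of a GOOD field has
order `≤ p`» (`CorCM/GaloisOddNormalHallSubgroup`) and «two non-trivial normal Sylow subgroups at distinct odd primes are fatal»
(`CorCM/GaloisOddSylowOrder`):

* `padicVal_le_one_of_forall_dvd_index` — `[K:ℚ] = pᵃ·r`, `p` odd, `p ∤ r`, `r ≥ 14`, no divisor `d ≠ 1` of `r` with `d ≡ 1 (mod p)`,
  `K` GOOD ⟹ `a ≤ 1`.
* `padicVal_le_one_of_two_pow_lt` — `[K:ℚ] = 2ⁿ·pᵃ` with `16 ≤ 2ⁿ < p` ⟹ `a ≤ 1` (the divisors `2ⁱ ≤ 2ⁿ < p` of the index are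
  never `≡ 1 (mod p)` unless `i = 0`); this covers degrees `16·pᵃ` (`p ≥ 17`), `32·pᵃ` (`p ≥ 37`), … below the reach of gen 33's size
  condition and of the `p ≥ 31` theorem.
* `exists_simple_degenerate_of_two_primes_of_forall_dvd_index` — two such primes both dividing the degree ⟹ BAD.

## References

* [Rotman1995] J. J. Rotman, *An Introduction to the Theory of Groups*, 4th ed., GTM 148, Thm. 4.12 (Sylow), Ex. 4.16.
* [Shimura1998] G. Shimura, *Abelian Varieties with Complex Multiplication and Modular Functions*, §8.2 Prop. 26, §32.10.
* [Dodson1984] B. Dodson, *The structure of Galois groups of CM-fields*, Trans. AMS 283 (1984), §3.1.1, §5.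
-/

noncomputable section

open CategoryTheory CategoryTheory.Limits NumberField
open scoped BigOperators

namespace Summit.HodgeConjecture.CorCM.GaloisModels

open Literature.NumberTheory.ComplexMultiplication Literature.AlgebraicGeometry.HodgeTheory
open Literature.AlgebraicGeometry.Motives (AbelianVariety CMType)
open Literature.AlgebraicGeometry.ComplexMultiplication (IsCMTypeRealisation)
open Literature.AlgebraicGeometry.Pohlmann1968 Summit.HodgeConjecture.CorCM.GaloisRank
open Literature.Barriers.HodgeConjecture (divisorClassesSpan)

/-! ## §1 Sylow counting -/

section Group

variable {G : Type*} [Group G] [Finite G] {p : ℕ} [Fact p.Prime]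

/-- **Sylow III as a normality criterion**: if the only divisor `d` of `[G:P]` with `d ≡ 1 (mod p)` is `d = 1`, the Sylow `p`-subgroup `P`
is normal. [cite: Rotman1995, Thm. 4.12] -/
theorem sylow_normal_of_forall_dvd_index (P : Sylow p G)
    (h : ∀ d : ℕ, d ∣ (P : Subgroup G).index → d ≡ 1 [MOD p] → d = 1) : (P : Subgroup G).Normal := by
  have h1 : Nat.card (Sylow p G) = 1 := h _ (Sylow.card_dvd_index P) (card_sylow_modEq_one p G)
  rw [Sylow.card_eq_index_normalizer P, Subgroup.index_eq_one] at h1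
  have h2 : Subgroup.normalizer ((P : Subgroup G) : Set G) = ⊤ := h1
  exact Subgroup.normalizer_eq_top_iff.mp h2

omit [Finite G] [Fact p.Prime] in
/-- Divisors of `2ⁿ` below `p` are not `≡ 1 (mod p)` except `1`: if `2ⁿ < p` then `d ∣ 2ⁿ`, `d ≡ 1 (mod p)` ⟹ `d = 1`. [folklore] -/
theorem eq_one_of_dvd_two_pow_of_modEq {n d : ℕ} (hp : 2 ^ n < p) (hd : d ∣ 2 ^ n) (hmod : d ≡ 1 [MOD p]) : d = 1 := by
  have hdle : d ≤ 2 ^ n := Nat.le_of_dvd (pow_pos two_pos n) hd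
  have hdpos : 0 < d := Nat.pos_of_dvd_of_pos hd (pow_pos two_pos n)
  have h1 : d % p = 1 % p := hmod
  rw [Nat.mod_eq_of_lt (by omega), Nat.mod_eq_of_lt (by omega)] at h1
  exact h1

end Group

/-! ## §2 GOOD fields: the `p`-part is at most `p` -/

variable {K : Type} [Field K] [NumberField K] [IsCMField K] [IsGalois ℚ K]

/-- **`[K:ℚ] = pᵃ·r` with no divisor `d ≠ 1` of `r` congruent to `1 (mod p)` ⟹ `a ≤ 1`** (`p` odd, `p ∤ r`, `r ≥ 14`, `K` GOOD): the Sylow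
`p`-subgroup is normal by counting, and a normal Sylow `p`-subgroup of index `≥ 14` of a GOOD field has order `≤ p`.
[cite: Rotman1995, Thm. 4.12] [cite: Shimura1998, §8.2 Prop. 26 and §32.10] [cite: Dodson1984, §3.1.1 and §5] -/
theorem padicVal_le_one_of_forall_dvd_index {p a r : ℕ} [hp : Fact p.Prime] (hp2 : p ≠ 2)
    (hdeg : Module.finrank ℚ K = p ^ a * r) (hpr : ¬ p ∣ r) (h14 : 14 ≤ r)
    (hdiv : ∀ d : ℕ, d ∣ r → d ≡ 1 [MOD p] → d = 1)
    (hgood : ∀ (Φ : CMType K) (φ : K →+* ℂ), IsPrimitive (ℂ ≃+* ℂ) Φ.1 φ → IsNondegenerate Φ) : a ≤ 1 := by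
  classical
  obtain ⟨P⟩ := (inferInstance : Nonempty (Sylow p (K ≃ₐ[ℚ] K)))
  obtain ⟨hcard, hidx⟩ := card_sylow_eq_of_finrank hdeg hpr P
  haveI : (P : Subgroup (K ≃ₐ[ℚ] K)).Normal :=
    sylow_normal_of_forall_dvd_index P (fun d hd hmod => hdiv d (by rw [← hidx]; exact hd) hmod)
  have h := card_sylow_le_of_normal hp2 P (by rw [hidx]; exact h14) hgood
  rw [hcard] at h
  exact le_one_of_pow_eq hp.out h

/-- **`[K:ℚ] = 2ⁿ·pᵃ` with `16 ≤ 2ⁿ < p` ⟹ `a ≤ 1`** for a GOOD Galois CM field — no size hypothesis (e.g. degrees `16·pᵃ` with `p ≥ 17`).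
[cite: Rotman1995, Thm. 4.12] [cite: Shimura1998, §8.2 Prop. 26 and §32.10] [cite: Dodson1984, §5] -/
theorem padicVal_le_one_of_two_pow_lt {p a n : ℕ} [hp : Fact p.Prime] (hdeg : Module.finrank ℚ K = 2 ^ n * p ^ a)
    (hn : 4 ≤ n) (hnp : 2 ^ n < p)
    (hgood : ∀ (Φ : CMType K) (φ : K →+* ℂ), IsPrimitive (ℂ ≃+* ℂ) Φ.1 φ → IsNondegenerate Φ) : a ≤ 1 := by
  have h16 : 16 ≤ 2 ^ n := le_trans (by norm_num) (Nat.pow_le_pow_right two_pos hn)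
  have hp2 : p ≠ 2 := by omega
  have hpr : ¬ p ∣ 2 ^ n := fun h => hp2 ((Nat.prime_dvd_prime_iff_eq hp.out Nat.prime_two).1 (hp.out.dvd_of_dvd_pow h))
  exact padicVal_le_one_of_forall_dvd_index hp2 (by rw [hdeg, mul_comm]) hpr (by omega)
    (fun d hd hmod => eq_one_of_dvd_two_pow_of_modEq hnp hd hmod) hgood

/-- **Two odd primes with «counting-normal» Sylow subgroups both dividing the degree ⟹ BAD**: `[K:ℚ] = pᵃ·qᵇ·r`, `p ≠ q` odd, `p, q ∤ r`,
`a, b ≥ 1`, `r ≥ 14`, and no divisor `≠ 1` of `qᵇ r` (resp. `pᵃ r`) is `≡ 1 (mod p)` (resp. `(mod q)`) ⟹ `K` carries a SIMPLE DEGENERATE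
abelian variety of dimension `[K:ℚ]/2`. [cite: Rotman1995, Thm. 4.12] [cite: Shimura1998, §6.2 Thm. 3 and §8.2 Prop. 26]
[cite: Dodson1984, §3.1.1 and §5] -/
theorem exists_simple_degenerate_of_two_primes_of_forall_dvd_index {p q a b r : ℕ} [hp : Fact p.Prime] [hq : Fact q.Prime]
    (hp2 : p ≠ 2) (hq2 : q ≠ 2) (hpq : p ≠ q) (hdeg : Module.finrank ℚ K = p ^ a * q ^ b * r) (hpr : ¬ p ∣ r) (hqr : ¬ q ∣ r)
    (ha : 1 ≤ a) (hb : 1 ≤ b) (h14 : 14 ≤ r) (hdivp : ∀ d : ℕ, d ∣ q ^ b * r → d ≡ 1 [MOD p] → d = 1)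
    (hdivq : ∀ d : ℕ, d ∣ p ^ a * r → d ≡ 1 [MOD q] → d = 1) :
    ∃ (Φ : CMType K) (φ : K →+* ℂ) (X : AbelianVariety ℂ) (ι : 𝓞 K →+* End X)
      (ϑ : K →+* Module.End ℂ (complexBetti X.X 1)),
      IsPrimitive (ℂ ≃+* ℂ) Φ.1 φ ∧ ¬ IsNondegenerate Φ ∧ IsCMTypeRealisation Φ X ι ϑ ∧ X.IsSimple ∧
      X.dim = Module.finrank ℚ K / 2 ∧
      ∃ n p : ℕ, ∃ x : complexBetti (⨁ fun _ : Fin n => X).X (2 * p), IsRationalClass x ∧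
        IsOfHodgeType (⨁ fun _ : Fin n => X).dim (⨁ fun _ : Fin n => X).X (2 * p) p p x ∧
        x ∉ divisorClassesSpan (⨁ fun _ : Fin n => X).X (⨁ fun _ : Fin n => X).dim p := by
  classical
  have hpp := hp.out
  have hqq := hq.out
  have hpqr : ¬ p ∣ q ^ b * r := fun h => by
    rcases (Nat.Prime.dvd_mul hpp).1 h with h | h
    · exact hpq ((Nat.prime_dvd_prime_iff_eq hpp hqq).1 (hpp.dvd_of_dvd_pow h))
    · exact hpr h
  have hqpr : ¬ q ∣ p ^ a * r := fun h => by
    rcases (Nat.Prime.dvd_mul hqq).1 h with h | h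
    · exact hpq ((Nat.prime_dvd_prime_iff_eq hqq hpp).1 (hqq.dvd_of_dvd_pow h)).symm
    · exact hqr h
  refine exists_simple_degenerate_of_two_primes_of_sylow_normal hp2 hq2 hpq hdeg hpr hqr ha hb h14 (fun P => ?_) (fun Q => ?_)
  · obtain ⟨-, hidx⟩ := card_sylow_eq_of_finrank (by rw [hdeg]; ring : Module.finrank ℚ K = p ^ a * (q ^ b * r)) hpqr P
    exact sylow_normal_of_forall_dvd_index P (fun d hd hmod => hdivp d (by rw [← hidx]; exact hd) hmod)
  · obtain ⟨-, hidx⟩ := card_sylow_eq_of_finrank (by rw [hdeg]; ring : Module.finrank ℚ K = q ^ b * (p ^ a * r)) hqpr Q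
    exact sylow_normal_of_forall_dvd_index Q (fun d hd hmod => hdivq d (by rw [← hidx]; exact hd) hmod)

end Summit.HodgeConjecture.CorCM.GaloisModels

end
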